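/-
Origin: expansion seat `planner-pub-hodgecm-pv10-g5-0`, handover #1 2026-08-18T14:12:38Z (`HOME/pub-hodgecm-pv10-g5/lean/Pv10g5/QuotientManifold.lean`, md5 8da13124, 217 lines);
landed by the gen-8 packager in gate run 30 as `HodgeCM/PerL34/QuotientManifold.lean` (stripped 3 #print/#check/#eval lines).
-/
/-
Origin: pub-hodgecm speedrun cell, seat pv10-g5 (DAG-NODE PROVER #10, gen 5), 2026-08-18.
Target path: `HodgeCM/PerL34/QuotientManifold.lean`.  Imports: Mathlib only.  KERNEL, nothing cited, nothing posited.
-/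
import Mathlib

/-!
# Quotient of a manifold by a free, properly discontinuous action by structure-preserving maps

Mathlib (`Mathlib/Geometry/Manifold/Instances/Quotient.lean`) endows the quotient
`MulAction.orbitRel.Quotient G M` of a charted space `M` (model `H`) by a free
(`IsCancelSMul`), properly discontinuous, continuous action of a group `G` with the pushed-forward
charted-space structure `MulAction.instChartedSpaceQuotient`, and leaves as a TODO:
"if `G` acts smoothly, the quotient is an `IsManifold I n`".

This file proves that TODO at the level of an arbitrary structure groupoid `Gr` closed under
restriction: if every `g : G` acts by `Gr`-maps in the charts of `M`
(`e.symm ≫ₕ (g • ·) ≫ₕ e' ∈ Gr` for all charts `e e'` of the atlas of `M`), then the quotient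
`HasGroupoid (orbitRel.Quotient G M) Gr` (`hasGroupoid_orbitRelQuotient`); in particular for
`Gr = contDiffGroupoid n I` the quotient is a `C^n` (`n = ω`: analytic) manifold
(`isManifold_orbitRelQuotient`).

## Proof

The charts of the quotient are `σ_p ≫ₕ chartAt H p` where `σ_p` is the chosen local inverse of the
covering map `π : M → M/G` through `p` (`IsLocalHomeomorph.localInverseAt`).  A transition map is
therefore `(chartAt H p).symm ≫ₕ (σ_p.symm ≫ₕ σ_{p'}) ≫ₕ chartAt H p'`, and the middle factor
`deck p p' := σ_p.symm ≫ₕ σ_{p'} : M → M` is a *local deck transformation*: it commutes with `π`, so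
`deck p p' z ∈ G • z` for every `z` in its source (`exists_smul_eq_deck`).  The key point
(`exists_deck_eventuallyEq_smul`) is that the group element is LOCALLY CONSTANT: near any point `x`
of its source, `deck p p'` agrees with `(g • ·)` for one fixed `g : G` — this uses the evenly-covered
neighbourhoods of the quotient covering map (`IsQuotientCoveringMap.disjoint`) and freeness.  Locality
of structure groupoids and closure under restriction then transfer the hypothesis on `(g • ·)` to the
transition maps.

## Main statements

* `HodgeCM.PerL34.QuotientManifold.hasGroupoid_orbitRelQuotient`
* `HodgeCM.PerL34.QuotientManifold.isManifold_orbitRelQuotient`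

Used by `HodgeCM/PerL34/BallQuotientManifold.lean` (the complex structure on `Γ \ 𝔹²`,
PerL v5 §1.2 ll. 72–73).
-/

noncomputable section

open MulAction Topology Set

namespace HodgeCM.PerL34.QuotientManifold

variable {G : Type*} [Group G] {M : Type*} [TopologicalSpace M] [MulAction G M]
  [ProperlyDiscontinuousSMul G M] [ContinuousConstSMul G M] [IsCancelSMul G M]
  [T2Space M] [LocallyCompactSpace M]

/-! ## §1  The quotient map and its local sections -/

variable (G M) in
/-- The quotient map `π : M → M/G` is a quotient covering map (Mathlib). -/
theorem isQuotientCoveringMap_mk :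
    IsQuotientCoveringMap (Quotient.mk (orbitRel G M) : M → orbitRel.Quotient G M) G :=
  isQuotientCoveringMap_quotientMk_of_properlyDiscontinuousSMul

variable (G M) in
/-- … hence a local homeomorphism. -/
theorem isLocalHomeomorph_mk :
    IsLocalHomeomorph (Quotient.mk (orbitRel G M) : M → orbitRel.Quotient G M) :=
  (isQuotientCoveringMap_mk G M).isCoveringMap.isLocalHomeomorph

variable (G) in
/-- The chosen local section `σ_p` of `π` through `p` (an open partial homeomorphism `M/G → M` with
`σ_p.symm = π` and `p ∈ σ_p.target`). -/
def localSection (p : M) : OpenPartialHomeomorph (orbitRel.Quotient G M) M :=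
  (isLocalHomeomorph_mk G M).localInverseAt p

/-- (Ported verbatim from the HodgeCMPerL package; no docstring in the source.) -/
theorem localSection_symm_apply (p z : M) :
    (localSection G p).symm z = Quotient.mk (orbitRel G M) z :=
  congrFun ((isLocalHomeomorph_mk G M).localInverseAt_symm p) z

/-- (Ported verbatim from the HodgeCMPerL package; no docstring in the source.) -/
theorem mk_localSection_apply (p : M) {q : orbitRel.Quotient G M} (hq : q ∈ (localSection G p).source) :
    Quotient.mk (orbitRel G M) (localSection G p q) = q :=
  (isLocalHomeomorph_mk G M).apply_localInverseAt_of_mem hq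

variable (G) in
/-- The local deck transformation `σ_p.symm ≫ₕ σ_{p'} : M → M`. -/
def deck (p p' : M) : OpenPartialHomeomorph M M :=
  (localSection G p).symm.trans (localSection G p')

/-- (Ported verbatim from the HodgeCMPerL package; no docstring in the source.) -/
theorem deck_apply (p p' z : M) : deck G p p' z = localSection G p' (Quotient.mk (orbitRel G M) z) := by
  rw [deck, OpenPartialHomeomorph.trans_apply, localSection_symm_apply]

/-- (Ported verbatim from the HodgeCMPerL package; no docstring in the source.) -/
theorem mk_deck_apply (p p' : M) {z : M} (hz : z ∈ (deck G p p').source) :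
    Quotient.mk (orbitRel G M) (deck G p p' z) = Quotient.mk (orbitRel G M) z := by
  rw [deck, OpenPartialHomeomorph.trans_source] at hz
  rw [deck_apply]
  apply mk_localSection_apply
  simpa [localSection_symm_apply] using hz.2

/-- A local deck transformation moves every point within its orbit. -/
theorem exists_smul_eq_deck (p p' : M) {z : M} (hz : z ∈ (deck G p p').source) :
    ∃ g : G, g • z = deck G p p' z :=
  mem_orbit_iff.mp ((isQuotientCoveringMap_mk G M).apply_eq_iff_mem_orbit.mp (mk_deck_apply p p' hz))

/-- **Key lemma.** A local deck transformation is, near every point of its source, the action of ONE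
group element. -/
theorem exists_deck_eventuallyEq_smul (p p' : M) {x : M} (hx : x ∈ (deck G p p').source) :
    ∃ g : G, (deck G p p' : M → M) =ᶠ[𝓝 x] fun z => g • z := by
  obtain ⟨g, hg⟩ := exists_smul_eq_deck p p' hx
  obtain ⟨U, hU, hdisj⟩ := (isQuotientCoveringMap_mk G M).disjoint x
  refine ⟨g, ?_⟩
  have hcont : ContinuousAt (fun z => g⁻¹ • deck G p p' z) x :=
    (continuous_const_smul g⁻¹).continuousAt.comp ((deck G p p').continuousAt hx)
  have hlim : g⁻¹ • deck G p p' x = x := by rw [← hg, inv_smul_smul]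
  have h3 : ∀ᶠ z in 𝓝 x, g⁻¹ • deck G p p' z ∈ U := by
    apply hcont.preimage_mem_nhds
    simpa only [hlim] using hU
  filter_upwards [h3, hU, (deck G p p').open_source.mem_nhds hx] with z hz hzU hzs
  obtain ⟨h, hh⟩ := exists_smul_eq_deck p p' hzs
  have h1 : g⁻¹ * h = 1 :=
    hdisj (g⁻¹ * h) ⟨g⁻¹ • deck G p p' z, ⟨z, hzU, by simp only [mul_smul, hh]⟩, hz⟩
  rw [inv_mul_eq_one] at h1
  rw [← hh, ← h1]

/-! ## §2  The atlas of the quotient -/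

/-- Every chart of the quotient is `σ_p ≫ₕ chartAt H p` for some `p : M`. -/
theorem exists_eq_localSection_trans {H : Type*} [TopologicalSpace H] [ChartedSpace H M]
    {e : OpenPartialHomeomorph (orbitRel.Quotient G M) H} (he : e ∈ atlas H (orbitRel.Quotient G M)) :
    ∃ p : M, e = (localSection G p).trans (chartAt H p) := by
  obtain ⟨q, rfl⟩ := he
  exact ⟨_, rfl⟩

/-! ## §3  A restriction lemma for open partial homeomorphisms -/

/-- If `τ` and `τ'` agree on an open set `W` inside both sources, then the conjugates
`c.symm ≫ₕ τ ≫ₕ c'` and `c.symm ≫ₕ τ' ≫ₕ c'` agree (as `EqOnSource`) after restriction to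
`c.target ∩ c.symm ⁻¹' W`. -/
theorem restr_conj_eqOnSource {X Y : Type*} [TopologicalSpace X] [TopologicalSpace Y]
    (c c' : OpenPartialHomeomorph X Y) (τ τ' : OpenPartialHomeomorph X X) {W : Set X} (hW : IsOpen W)
    (hWτ : W ⊆ τ.source) (hWτ' : W ⊆ τ'.source) (heq : EqOn τ τ' W) :
    (c.symm.trans (τ.trans c')).restr (c.target ∩ c.symm ⁻¹' W) ≈
      (c.symm.trans (τ'.trans c')).restr (c.target ∩ c.symm ⁻¹' W) := by
  have hs : IsOpen (c.target ∩ c.symm ⁻¹' W) := c.isOpen_inter_preimage_symm hW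
  refine ⟨?_, ?_⟩
  · rw [OpenPartialHomeomorph.restr_source' _ _ hs, OpenPartialHomeomorph.restr_source' _ _ hs]
    ext y
    simp only [OpenPartialHomeomorph.trans_source, OpenPartialHomeomorph.symm_source, mem_inter_iff,
      mem_preimage]
    constructor
    · rintro ⟨⟨hy, -, h2⟩, -, hyW⟩
      exact ⟨⟨hy, hWτ' hyW, by rwa [← heq hyW]⟩, hy, hyW⟩
    · rintro ⟨⟨hy, -, h2⟩, -, hyW⟩
      exact ⟨⟨hy, hWτ hyW, by rwa [heq hyW]⟩, hy, hyW⟩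
  · intro y hy
    rw [OpenPartialHomeomorph.restr_source' _ _ hs] at hy
    obtain ⟨-, -, hyW⟩ := hy
    simp only [OpenPartialHomeomorph.restr_apply, OpenPartialHomeomorph.trans_apply, heq hyW]

/-! ## §4  The structure groupoid descends to the quotient -/

section Groupoid

variable {H : Type*} [TopologicalSpace H] [ChartedSpace H M]

/-- **The quotient of a `Gr`-manifold by a free, properly discontinuous action by `Gr`-maps is a
`Gr`-manifold** (for the charted-space structure `MulAction.instChartedSpaceQuotient`), for every
structure groupoid `Gr` closed under restriction.  The hypothesis `hG` says that each `g : G` acts by an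
element of `Gr` when read in any two charts of `M`. -/
theorem hasGroupoid_orbitRelQuotient (Gr : StructureGroupoid H) [ClosedUnderRestriction Gr]
    (hG : ∀ g : G, ∀ e ∈ atlas H M, ∀ e' ∈ atlas H M,
      e.symm.trans ((Homeomorph.smul g : M ≃ₜ M).toOpenPartialHomeomorph.trans e') ∈ Gr) :
    HasGroupoid (orbitRel.Quotient G M) Gr where
  compatible := by
    rintro e e' he he'
    obtain ⟨p, rfl⟩ := exists_eq_localSection_trans he
    obtain ⟨p', rfl⟩ := exists_eq_localSection_trans he'
    rw [OpenPartialHomeomorph.trans_symm_eq_symm_trans_symm, OpenPartialHomeomorph.trans_assoc,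
      ← OpenPartialHomeomorph.trans_assoc (localSection G p).symm]
    change (chartAt H p).symm.trans ((deck G p p').trans (chartAt H p')) ∈ Gr
    apply Gr.locality
    intro y hy
    have hy' := hy
    simp only [OpenPartialHomeomorph.trans_source, OpenPartialHomeomorph.symm_source, mem_inter_iff,
      mem_preimage] at hy'
    obtain ⟨hyt, hx, -⟩ := hy'
    obtain ⟨g, hg⟩ := exists_deck_eventuallyEq_smul p p' hx
    obtain ⟨V, hV, hVo, hxV⟩ := eventually_nhds_iff.mp hg
    have hWo : IsOpen ((deck G p p').source ∩ V) := (deck G p p').open_source.inter hVo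
    refine ⟨(chartAt H p).target ∩ (chartAt H p).symm ⁻¹' ((deck G p p').source ∩ V),
      (chartAt H p).isOpen_inter_preimage_symm hWo, ⟨hyt, hx, hxV⟩, ?_⟩
    refine Gr.mem_of_eqOnSource
      (closedUnderRestriction' (hG g _ (chart_mem_atlas H p) _ (chart_mem_atlas H p'))
        ((chartAt H p).isOpen_inter_preimage_symm hWo)) ?_
    exact restr_conj_eqOnSource (chartAt H p) (chartAt H p') (deck G p p')
      (Homeomorph.smul g : M ≃ₜ M).toOpenPartialHomeomorph hWo inter_subset_left
      (by simp only [Homeomorph.toOpenPartialHomeomorph_source, subset_univ])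
      (fun z hz => hV z hz.2)

/-- **Mathlib's TODO (`Geometry/Manifold/Instances/Quotient.lean`): if `G` acts by `C^n` maps, the
quotient `M/G` is a `C^n` manifold.**  Here "acts by `C^n` maps" is expressed chart-wise: each
`e.symm ≫ₕ (g • ·) ≫ₕ e'` lies in `contDiffGroupoid n I`. -/
theorem isManifold_orbitRelQuotient {𝕜 : Type*} [NontriviallyNormedField 𝕜] {E : Type*}
    [NormedAddCommGroup E] [NormedSpace 𝕜 E] (I : ModelWithCorners 𝕜 E H) (n : WithTop ℕ∞)
    (hG : ∀ g : G, ∀ e ∈ atlas H M, ∀ e' ∈ atlas H M,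
      e.symm.trans ((Homeomorph.smul g : M ≃ₜ M).toOpenPartialHomeomorph.trans e') ∈ contDiffGroupoid n I) :
    IsManifold I n (orbitRel.Quotient G M) :=
  haveI := hasGroupoid_orbitRelQuotient (contDiffGroupoid n I) hG
  IsManifold.mk' I n _

end Groupoid

end HodgeCM.PerL34.QuotientManifold

end

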